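import Literature.NumberTheory.EllipticCurves.TwoDescentLocalGeneral
import HarnessLib

/-!
# The local conditions of the `2`-descent at an odd place of additive type, abstractly

Companion of `TwoDescentLocalGeneral.lean` (`OddPlace.local_conditions_of_mult`). Let `𝔳` be an
odd place of a field `F` (an abstract valuation `v` with a quadratic-residue bit `χ`,
`TwoDescentLocal.OddPlace`) and `e₁, e₂, e₃ ∈ F` with
`v(e₁ - e₂) = v(e₁ - e₃) = v(e₂ - e₃) = 1` — the situation of a quadratic twist `E^{(d)}`,
`eᵢ = d eᵢ'`, at a prime `v ∣ d` where `E` has good reduction (additive, potentially good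
reduction of `E^{(d)}`). For every `F`-point `(x, y)`, `y ≠ 0`, of `y² = (x - e₁)(x - e₂)(x - e₃)`
the classes of `(x - e₁, x - e₂)` lie in the image of the `2`-torsion,
`{1, ((e₁-e₂)(e₁-e₃), e₁-e₂), (e₂-e₁, (e₂-e₁)(e₂-e₃)), (e₃-e₁, e₃-e₂)}`; in bits
(`OddPlace.local_conditions_of_add`):

* `χ(x - e₁) = parity(x - e₁) χ(e₂ - e₁) + parity(x - e₂) χ((e₁ - e₂)(e₁ - e₃))`,
* `χ(x - e₂) = parity(x - e₁) χ((e₂ - e₁)(e₂ - e₃)) + parity(x - e₂) χ(e₁ - e₂)`.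

The proof is the case analysis on `v(x - e₁) ≤ 0`, `≥ 2`, `= 1` (and then which of `x - e₂`,
`x - e₃` has valuation `1`), using only the ultrametric inequality and the local constancy of `χ`
(Silverman, *AEC*, proof of Prop. X.1.4 / Example X.1.5, at a prime of additive reduction).

## References

* J. H. Silverman, *The Arithmetic of Elliptic Curves*, 2nd ed., GTM 106 (2009), Prop. X.1.4,
  Example X.1.5. [SilvermanAEC2009]
-/

namespace Literature.NumberTheory.EllipticCurves.TwoDescentLocal

namespace OddPlace

variable {F : Type*} [Field F] {𝔳 : OddPlace F} {e₁ e₂ e₃ x y : F}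

/-- `χ(a) + χ(-a) = χ(-1)`. [folklore] -/
theorem χ_add_χ_neg (𝔳 : OddPlace F) {a : F} (ha : a ≠ 0) : 𝔳.χ a + 𝔳.χ (-a) = 𝔳.χ (-1) := by
  rw [𝔳.χ_neg ha]
  have : 𝔳.χ a + 𝔳.χ a = 0 := CharTwo.add_self_eq_zero _
  linear_combination this

/-- **The local conditions at an odd place of additive type, abstractly.** Let `𝔳` be an odd
place of `F` and `e₁, e₂, e₃ ∈ F` distinct with `v(e₁ - e₂) = v(e₁ - e₃) = v(e₂ - e₃) = 1`. For
every `F`-point `(x, y)`, `y ≠ 0`, of `y² = (x - e₁)(x - e₂)(x - e₃)`: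
`χ(x - e₁) = parity(x - e₁) χ(e₂ - e₁) + parity(x - e₂) χ((e₁ - e₂)(e₁ - e₃))` and
`χ(x - e₂) = parity(x - e₁) χ((e₂ - e₁)(e₂ - e₃)) + parity(x - e₂) χ(e₁ - e₂)` — membership of
`(x - e₁, x - e₂)` in the image `{δ(O), δ(T₁), δ(T₂), δ(T₃)}` of the `2`-torsion, the whole local
image at a prime of additive (potentially good) reduction of a quadratic twist.
[cite: SilvermanAEC2009, Prop. X.1.4] -/
theorem local_conditions_of_add (h₁₂ : 𝔳.v (e₁ - e₂) = 1) (h₁₃ : 𝔳.v (e₁ - e₃) = 1)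
    (h₂₃ : 𝔳.v (e₂ - e₃) = 1) (he₁₂ : e₁ ≠ e₂) (he₁₃ : e₁ ≠ e₃) (he₂₃ : e₂ ≠ e₃)
    (hy : y ≠ 0) (h : y ^ 2 = (x - e₁) * (x - e₂) * (x - e₃)) :
    𝔳.χ (x - e₁) = 𝔳.parity (x - e₁) * 𝔳.χ (e₂ - e₁) +
        𝔳.parity (x - e₂) * 𝔳.χ ((e₁ - e₂) * (e₁ - e₃)) ∧
      𝔳.χ (x - e₂) = 𝔳.parity (x - e₁) * 𝔳.χ ((e₂ - e₁) * (e₂ - e₃)) +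
        𝔳.parity (x - e₂) * 𝔳.χ (e₁ - e₂) := by
  obtain ⟨hx₁, hx₂, hx₃⟩ := factors_ne_zero' hy h
  have hsum := even_sum_v (𝔳 := 𝔳) hy h
  have hbits := χ_add_add_eq_zero (𝔳 := 𝔳) hy h
  -- the constants
  have he₁₂' : e₁ - e₂ ≠ 0 := sub_ne_zero.mpr he₁₂
  have he₁₃' : e₁ - e₃ ≠ 0 := sub_ne_zero.mpr he₁₃
  have he₂₁' : e₂ - e₁ ≠ 0 := sub_ne_zero.mpr (Ne.symm he₁₂)
  have he₂₃' : e₂ - e₃ ≠ 0 := sub_ne_zero.mpr he₂₃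
  have he₃₁' : e₃ - e₁ ≠ 0 := sub_ne_zero.mpr (Ne.symm he₁₃)
  have he₃₂' : e₃ - e₂ ≠ 0 := sub_ne_zero.mpr (Ne.symm he₂₃)
  have hv₂₁ : 𝔳.v (e₂ - e₁) = 1 := by rw [𝔳.v_sub_comm, h₁₂]
  have hv₃₁ : 𝔳.v (e₃ - e₁) = 1 := by rw [𝔳.v_sub_comm, h₁₃]
  have hv₃₂ : 𝔳.v (e₃ - e₂) = 1 := by rw [𝔳.v_sub_comm, h₂₃]
  have hχ₁₂ : 𝔳.χ ((e₁ - e₂) * (e₁ - e₃)) = 𝔳.χ (e₁ - e₂) + 𝔳.χ (e₁ - e₃) := 𝔳.χ_mul he₁₂' he₁₃'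
  have hχ₂₁ : 𝔳.χ ((e₂ - e₁) * (e₂ - e₃)) = 𝔳.χ (e₂ - e₁) + 𝔳.χ (e₂ - e₃) := 𝔳.χ_mul he₂₁' he₂₃'
  have n₁₂ := 𝔳.χ_add_χ_neg he₁₂'
  have n₁₃ := 𝔳.χ_add_χ_neg he₁₃'
  have n₂₃ := 𝔳.χ_add_χ_neg he₂₃'
  rw [neg_sub] at n₁₂ n₁₃ n₂₃
  -- parity values
  have p0 : ∀ {a : F}, Even (𝔳.v a) → 𝔳.parity a = 0 := fun h => (𝔳.parity_eq_zero_iff _).mpr h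
  have p1 : ∀ {a : F}, 𝔳.v a = 1 → 𝔳.parity a = 1 := fun h =>
    𝔳.parity_eq_one_of_not_even (by rw [h]; exact Int.not_even_one)
  -- the relations between the factors
  have r₂ : x - e₂ = (x - e₁) + (e₁ - e₂) := by ring
  have r₃ : x - e₃ = (x - e₁) + (e₁ - e₃) := by ring
  have aux3 : ∀ b : ZMod 2, b + b + b = 0 → b = 0 := by decide
  rcases lt_trichotomy (𝔳.v (x - e₁)) 1 with hlt | hone | hgt
  · -- Case `v(x - e₁) ≤ 0`: all three factors dominate equally; everything is a square class
    have d₂ := 𝔳.add_eq_left_of_lt hx₁ he₁₂' (by rw [h₁₂]; exact hlt)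
    have d₃ := 𝔳.add_eq_left_of_lt hx₁ he₁₃' (by rw [h₁₃]; exact hlt)
    rw [← r₂] at d₂
    rw [← r₃] at d₃
    have heven : Even (𝔳.v (x - e₁)) := by
      rw [d₂.2, d₃.2] at hsum
      obtain ⟨k, hk⟩ := hsum
      exact ⟨k - 𝔳.v (x - e₁), by omega⟩
    have q₂ : 𝔳.χ (x - e₂) = 𝔳.χ (x - e₁) := by
      rw [r₂]; exact 𝔳.χ_add_of_lt' hx₁ he₁₂' (by rw [h₁₂]; exact hlt)
    have q₃ : 𝔳.χ (x - e₃) = 𝔳.χ (x - e₁) := by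
      rw [r₃]; exact 𝔳.χ_add_of_lt' hx₁ he₁₃' (by rw [h₁₃]; exact hlt)
    rw [q₂, q₃] at hbits
    have hχ := aux3 _ hbits
    have hp₂ : 𝔳.parity (x - e₂) = 0 := p0 (by rw [d₂.2]; exact heven)
    rw [q₂, hχ, p0 heven, hp₂]
    simp
  · -- Case `v(x - e₁) = 1`: exactly one of `x - e₂`, `x - e₃` has valuation `1`
    have hp₁ : 𝔳.parity (x - e₁) = 1 := p1 hone
    have hge₂ : 1 ≤ 𝔳.v (x - e₂) := by
      have := 𝔳.le_add_or (a := x - e₁) (b := e₁ - e₂) (c := 1) (Or.inr hone.ge) (Or.inr h₁₂.ge)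
      rw [← r₂] at this
      exact this.resolve_left hx₂
    have hge₃ : 1 ≤ 𝔳.v (x - e₃) := by
      have := 𝔳.le_add_or (a := x - e₁) (b := e₁ - e₃) (c := 1) (Or.inr hone.ge) (Or.inr h₁₃.ge)
      rw [← r₃] at this
      exact this.resolve_left hx₃
    -- not both `≥ 2`
    have hnot : ¬ (2 ≤ 𝔳.v (x - e₂) ∧ 2 ≤ 𝔳.v (x - e₃)) := by
      rintro ⟨h2, h3⟩
      have := 𝔳.le_add_or (a := x - e₃) (b := -(x - e₂)) (c := 2) (Or.inr h3)
        (Or.inr (by rw [𝔳.v_neg]; exact h2))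
      rw [show x - e₃ + -(x - e₂) = e₂ - e₃ by ring] at this
      rcases this with h0 | h0
      · exact he₂₃' h0
      · rw [h₂₃] at h0; exact absurd h0 (by norm_num)
    rw [hone] at hsum
    by_cases hB : 𝔳.v (x - e₂) = 1
    · -- `v(x - e₂) = 1`, `v(x - e₃) ≥ 2` even: `x - e₁ ≡ e₃ - e₁`, `x - e₂ ≡ e₃ - e₂`
      have hC : 2 ≤ 𝔳.v (x - e₃) := by
        rcases (show 𝔳.v (x - e₃) = 1 ∨ 2 ≤ 𝔳.v (x - e₃) by omega) with h3 | h3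
        · exfalso; rw [hB, h3] at hsum; exact absurd hsum (by decide)
        · exact h3
      have q₁ : 𝔳.χ (x - e₁) = 𝔳.χ (e₃ - e₁) := by
        rw [show x - e₁ = (e₃ - e₁) + (x - e₃) by ring]
        exact 𝔳.χ_add_of_lt' he₃₁' hx₃ (by rw [hv₃₁]; omega)
      have q₂ : 𝔳.χ (x - e₂) = 𝔳.χ (e₃ - e₂) := by
        rw [show x - e₂ = (e₃ - e₂) + (x - e₃) by ring]
        exact 𝔳.χ_add_of_lt' he₃₂' hx₃ (by rw [hv₃₂]; omega)
      rw [q₁, q₂, hp₁, p1 hB, hχ₁₂, hχ₂₁, one_mul, one_mul]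
      revert n₁₂ n₁₃ n₂₃
      generalize 𝔳.χ (e₁ - e₂) = a₁; generalize 𝔳.χ (e₂ - e₁) = a₂; generalize 𝔳.χ (e₁ - e₃) = a₃
      generalize 𝔳.χ (e₃ - e₁) = a₄; generalize 𝔳.χ (e₂ - e₃) = a₅; generalize 𝔳.χ (e₃ - e₂) = a₆
      generalize 𝔳.χ (-1) = c
      revert a₁ a₂ a₃ a₄ a₅ a₆ c; decide
    · -- `v(x - e₂) ≥ 2`, `v(x - e₃) = 1`: `x - e₁ ≡ e₂ - e₁`, `x - e₃ ≡ e₂ - e₃`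
      have hB2 : 2 ≤ 𝔳.v (x - e₂) := by omega
      have hC : 𝔳.v (x - e₃) = 1 := by
        by_contra h3; exact hnot ⟨hB2, by omega⟩
      have hBeven : Even (𝔳.v (x - e₂)) := by
        rw [hC] at hsum
        obtain ⟨k, hk⟩ := hsum
        exact ⟨k - 1, by omega⟩
      have q₁ : 𝔳.χ (x - e₁) = 𝔳.χ (e₂ - e₁) := by
        rw [show x - e₁ = (e₂ - e₁) + (x - e₂) by ring]
        exact 𝔳.χ_add_of_lt' he₂₁' hx₂ (by rw [hv₂₁]; omega)
      have q₃ : 𝔳.χ (x - e₃) = 𝔳.χ (e₂ - e₃) := by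
        rw [show x - e₃ = (e₂ - e₃) + (x - e₂) by ring]
        exact 𝔳.χ_add_of_lt' he₂₃' hx₂ (by rw [h₂₃]; omega)
      have q₂ : 𝔳.χ (x - e₂) = 𝔳.χ (e₂ - e₁) + 𝔳.χ (e₂ - e₃) := by
        rw [q₁, q₃] at hbits
        revert hbits
        generalize 𝔳.χ (x - e₂) = b; generalize 𝔳.χ (e₂ - e₁) = a₂; generalize 𝔳.χ (e₂ - e₃) = a₅
        revert b a₂ a₅; decide
      rw [q₁, q₂, hp₁, p0 hBeven, hχ₂₁, one_mul, one_mul, zero_mul, zero_mul, add_zero, add_zero]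
      exact ⟨rfl, rfl⟩
  · -- Case `v(x - e₁) ≥ 2`: the other two factors are `≡ e₁ - e₂`, `e₁ - e₃`, of valuation `1`
    have d₂ := 𝔳.add_eq_left_of_lt he₁₂' hx₁ (by rw [h₁₂]; exact hgt)
    have d₃ := 𝔳.add_eq_left_of_lt he₁₃' hx₁ (by rw [h₁₃]; exact hgt)
    rw [add_comm, ← r₂] at d₂
    rw [add_comm, ← r₃] at d₃
    have heven : Even (𝔳.v (x - e₁)) := by
      rw [d₂.2, d₃.2, h₁₂, h₁₃] at hsum
      obtain ⟨k, hk⟩ := hsum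
      exact ⟨k - 1, by omega⟩
    have q₂ : 𝔳.χ (x - e₂) = 𝔳.χ (e₁ - e₂) := by
      rw [r₂, add_comm]; exact 𝔳.χ_add_of_lt' he₁₂' hx₁ (by rw [h₁₂]; exact hgt)
    have q₃ : 𝔳.χ (x - e₃) = 𝔳.χ (e₁ - e₃) := by
      rw [r₃, add_comm]; exact 𝔳.χ_add_of_lt' he₁₃' hx₁ (by rw [h₁₃]; exact hgt)
    have q₁ : 𝔳.χ (x - e₁) = 𝔳.χ (e₁ - e₂) + 𝔳.χ (e₁ - e₃) := by
      rw [q₂, q₃] at hbits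
      revert hbits
      generalize 𝔳.χ (x - e₁) = b; generalize 𝔳.χ (e₁ - e₂) = a₁; generalize 𝔳.χ (e₁ - e₃) = a₃
      revert b a₁ a₃; decide
    have hp₂ : 𝔳.parity (x - e₂) = 1 := p1 (by rw [d₂.2, h₁₂])
    rw [q₁, q₂, p0 heven, hp₂, hχ₁₂, zero_mul, zero_mul, one_mul, one_mul, zero_add, zero_add]
    exact ⟨rfl, rfl⟩

end OddPlace

end Literature.NumberTheory.EllipticCurves.TwoDescentLocal
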